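import Literature.Analysis.Complex.UnitDiscHyperbolicAut
import Mathlib.Analysis.SpecialFunctions.Pow.Complex
import Mathlib.Analysis.Complex.Conformal
import HarnessLib

/-!
# Generators of `Aut(𝔻)`: rotations and half-turns, and their divisibility

Topic `Literature/Analysis/Complex`.  Elementary structure of the group of holomorphic automorphisms
of the unit disc (Beardon, *The Geometry of Discrete Groups*, §7.33 – §7.4), in the language of
`UnitDiscAutomorphisms` / `UnitDiscHyperbolic`:

* `exists_discHalfTurn_comp_eq_discMobius` — every `φ_a` is a product of two half-turns
  `σ_q ∘ σ_0` (with `σ_q 0 = -a`), hence every automorphism `z ↦ c·φ_a(z)` is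
  `R_c ∘ σ_q ∘ σ_0` (`discRot_eqOn_mul_halfTurn_halfTurn`);
* `exists_root_rotation` — rotations are infinitely divisible (`c = d ^ n`);
* `exists_root_discHalfTurn` — half-turns are infinitely divisible inside `Aut(𝔻)` (`σ_q` is the
  `n`-th iterate of the rotation by `π/n` about `q`);
* `discCosh_conj`, squares of (anti-)Möbius maps are Möbius, an anti-Möbius map is not an
  automorphism (`not_isDiscAut_discRot_conj`).

These serve the commensurable-terminality and index-two clauses of [AbsTopIII] Prop. 2.2 (ii).
Proof-only file.
-/

noncomputable section

open Set Filter Metric Function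
open _root_.Complex
open scoped ComplexConjugate Topology

namespace Literature.Analysis.Complex

/-! ### `φ_a` as a product of two half-turns -/

/-- The point `q` with `σ_q(0) = -a`: `q = -a/(1 + √(1 - ‖a‖²))`. [cite: Beardon1983, §7.33] -/
theorem exists_discHalfTurn_apply_zero_eq {a : ℂ} (ha : ‖a‖ < 1) :
    ∃ q : ℂ, ‖q‖ < 1 ∧ discHalfTurn q 0 = -a := by
  set s := Real.sqrt (1 - ‖a‖ ^ 2) with hs
  have hs0 : 0 < s := Real.sqrt_pos.2 (by nlinarith [norm_nonneg a])
  have hs2 : s ^ 2 = 1 - ‖a‖ ^ 2 := Real.sq_sqrt (by nlinarith [norm_nonneg a])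
  have hs1 : s ≤ 1 := by nlinarith [norm_nonneg a]
  set q : ℂ := -a / (1 + s) with hq
  have h1s : (0 : ℝ) < 1 + s := by linarith
  have hqn : ‖q‖ = ‖a‖ / (1 + s) := by
    rw [hq, norm_div, norm_neg]
    congr 1
    rw [show (1 + (s : ℂ)) = ((1 + s : ℝ) : ℂ) by push_cast; ring, Complex.norm_real,
      Real.norm_of_nonneg h1s.le]
  refine ⟨q, ?_, ?_⟩
  · rw [hqn, div_lt_one h1s]; linarith
  · rw [discHalfTurn_apply_zero]
    have hqq : conj q * q = ((‖a‖ ^ 2 / (1 + s) ^ 2 : ℝ) : ℂ) := by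
      rw [conj_mul', ← ofReal_pow, hqn, div_pow]
    rw [hqq, hq]
    have h2 : (1 : ℂ) + ((‖a‖ ^ 2 / (1 + s) ^ 2 : ℝ) : ℂ) = ((2 / (1 + s) : ℝ) : ℂ) := by
      have : (1 : ℝ) + ‖a‖ ^ 2 / (1 + s) ^ 2 = 2 / (1 + s) := by
        rw [show ‖a‖ ^ 2 = 1 - s ^ 2 by linarith [hs2]]
        field_simp
        ring
      rw [← this]; push_cast; ring
    rw [h2]
    have h3 : ((2 / (1 + s) : ℝ) : ℂ) ≠ 0 := by
      rw [ofReal_ne_zero]; positivity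
    field_simp
    push_cast
    ring

/-- **Every `φ_a` is a product of two half-turns**: `φ_a = σ_q ∘ σ_0` on the disc, where
`σ_q(0) = -a` (Beardon §7.33: hyperbolic translations are products of two geodesic symmetries).
[cite: Beardon1983, §7.33] -/
theorem exists_discHalfTurn_comp_eq_discMobius {a : ℂ} (ha : ‖a‖ < 1) :
    ∃ q : ℂ, ‖q‖ < 1 ∧ EqOn (discMobius a) (discHalfTurn q ∘ discHalfTurn 0) (ball 0 1) := by
  obtain ⟨q, hq, hq0⟩ := exists_discHalfTurn_apply_zero_eq ha
  refine ⟨q, hq, ?_⟩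
  have ha' : ‖-a‖ < 1 := by rwa [norm_neg]
  -- `g := σ_q ∘ σ_0 ∘ φ_{-a}` is an automorphism fixing `0` and `-a`
  set g := discHalfTurn q ∘ discHalfTurn 0 ∘ discMobius (-a) with hg
  have hgaut : IsDiscAut g := (isDiscAut_discHalfTurn hq).comp
    ((isDiscAut_discHalfTurn (by simp)).comp (isDiscAut_discMobius ha'))
  have hg0 : g 0 = 0 := by
    simp only [hg, comp_apply, discMobius_zero, neg_neg, discHalfTurn_zero_left]
    rw [← hq0, discHalfTurn_discHalfTurn hq (by simp)]
  by_cases ha0 : a = 0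
  · subst ha0
    have hq' : q = 0 := by
      have h := hq0
      rw [discHalfTurn_apply_zero, neg_zero, mul_eq_zero] at h
      rcases h with h | h
      · exfalso
        have : (1 + conj q * q) ≠ 0 := by
          rw [conj_mul', ← ofReal_pow, ← ofReal_one, ← ofReal_add, ofReal_ne_zero]; positivity
        exact absurd h (div_ne_zero two_ne_zero this)
      · exact h
    subst hq'
    intro z hz
    simp [discMobius]
  · have hfix : g (-a) = -a := by
      simp only [hg, comp_apply]
      rw [show discMobius (-a) (-a) = 0 from discMobius_self (-a), discHalfTurn_zero_left, neg_zero, hq0]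
    have hgid := hgaut.eqOn_id_of_map_zero_of_fixed hg0 ha' (neg_ne_zero.2 ha0) hfix
    intro z hz
    have hz' : ‖z‖ < 1 := mem_ball_zero_iff.1 hz
    have hm : discMobius a z ∈ ball (0 : ℂ) 1 := mapsTo_discMobius ha hz
    have h := hgid hm
    simp only [hg, comp_apply, id] at h
    rw [show discMobius (-a) (discMobius a z) = z from discMobius_neg_discMobius ha hz'.le] at h
    exact h.symm

/-- **`Aut(𝔻)` is generated by rotations and half-turns**: `c·φ_a = R_c ∘ σ_q ∘ σ_0` on the disc.
[cite: Beardon1983, §7.33] -/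
theorem discRot_eqOn_mul_halfTurn_halfTurn {c a : ℂ} (ha : ‖a‖ < 1) :
    ∃ q : ℂ, ‖q‖ < 1 ∧
      EqOn (discRot c a) ((fun z => c * z) ∘ discHalfTurn q ∘ discHalfTurn 0) (ball 0 1) := by
  obtain ⟨q, hq, he⟩ := exists_discHalfTurn_comp_eq_discMobius ha
  exact ⟨q, hq, fun z hz => by rw [discRot, he hz]; rfl⟩

/-! ### Divisibility -/

/-- Unit complex numbers have unit `n`-th roots. [folklore] -/
private theorem exists_pow_eq_of_norm_eq_one {c : ℂ} (hc : ‖c‖ = 1) {n : ℕ} (hn : n ≠ 0) :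
    ∃ d : ℂ, ‖d‖ = 1 ∧ d ^ n = c := by
  refine ⟨c ^ ((n : ℂ)⁻¹), ?_, Complex.cpow_nat_inv_pow c hn⟩
  have h := congrArg (fun z : ℂ => ‖z‖) (Complex.cpow_nat_inv_pow c hn)
  simp only [norm_pow, hc] at h
  exact (pow_eq_one_iff_of_nonneg (norm_nonneg _) hn).1 h

/-- **Rotations are infinitely divisible**: `z ↦ c z` is the `n`-th iterate of `z ↦ d z` with
`d ^ n = c`, `‖d‖ = 1`. [cite: Beardon1983, §7.33] -/
theorem exists_root_rotation {c : ℂ} (hc : ‖c‖ = 1) {n : ℕ} (hn : n ≠ 0) :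
    ∃ d : ℂ, ‖d‖ = 1 ∧ ∀ z, (fun w => d * w)^[n] z = c * z := by
  obtain ⟨d, hd, hdn⟩ := exists_pow_eq_of_norm_eq_one hc hn
  refine ⟨d, hd, fun z => ?_⟩
  have : ∀ m : ℕ, (fun w => d * w)^[m] z = d ^ m * z := by
    intro m
    induction m with
    | zero => simp
    | succ m ih => rw [Function.iterate_succ_apply', ih, pow_succ]; ring
  rw [this, hdn]

/-- The rotation by the angle of `d` about `q`: `φ_{-q} ∘ (d ·) ∘ φ_q`, an automorphism of the disc.
[cite: Beardon1983, §7.33] -/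
theorem isDiscAut_conj_rotation {q d : ℂ} (hq : ‖q‖ < 1) (hd : ‖d‖ = 1) :
    IsDiscAut (discMobius (-q) ∘ (fun z => d * z) ∘ discMobius q) :=
  (isDiscAut_discMobius (by rwa [norm_neg])).comp ((isDiscAut_mul hd).comp (isDiscAut_discMobius hq))

/-- Iterates of the rotation about `q` are rotations about `q`: on the disc,
`(φ_{-q} ∘ (d ·) ∘ φ_q)^[n] = φ_{-q} ∘ (d^n ·) ∘ φ_q`. [cite: Beardon1983, §7.33] -/
theorem iterate_conj_rotation {q d : ℂ} (hq : ‖q‖ < 1) (hd : ‖d‖ = 1) (n : ℕ) {z : ℂ}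
    (hz : z ∈ ball (0 : ℂ) 1) :
    (discMobius (-q) ∘ (fun z => d * z) ∘ discMobius q)^[n] z =
      discMobius (-q) (d ^ n * discMobius q z) := by
  have hq' : ‖-q‖ < 1 := by rwa [norm_neg]
  induction n with
  | zero => simpa using (discMobius_neg_discMobius hq (mem_ball_zero_iff.1 hz).le).symm
  | succ n ih =>
    rw [Function.iterate_succ_apply', ih]
    simp only [comp_apply]
    have hmem : d ^ n * discMobius q z ∈ ball (0 : ℂ) 1 := by
      have := mapsTo_mul_ball (c := d ^ n) (by rw [norm_pow, hd, one_pow]) (mapsTo_discMobius hq hz)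
      simpa using this
    rw [show discMobius q (discMobius (-q) (d ^ n * discMobius q z)) = d ^ n * discMobius q z by
      simpa using discMobius_neg_discMobius hq' (mem_ball_zero_iff.1 hmem).le, pow_succ]
    ring_nf

/-- **Half-turns are infinitely divisible in `Aut(𝔻)`**: `σ_q` is the `n`-th iterate of the
rotation by `π/n` about `q` (an automorphism of the disc), on the disc. [cite: Beardon1983, §7.33] -/
theorem exists_root_discHalfTurn {q : ℂ} (hq : ‖q‖ < 1) {n : ℕ} (hn : n ≠ 0) :
    ∃ r : ℂ → ℂ, IsDiscAut r ∧ ∀ z ∈ ball (0 : ℂ) 1, r^[n] z = discHalfTurn q z := by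
  obtain ⟨d, hd, hdn⟩ := exists_pow_eq_of_norm_eq_one (c := -1) (by simp) hn
  refine ⟨discMobius (-q) ∘ (fun z => d * z) ∘ discMobius q, isDiscAut_conj_rotation hq hd,
    fun z hz => ?_⟩
  rw [iterate_conj_rotation hq hd n hz, hdn, discHalfTurn, neg_one_mul]

/-! ### Anti-Möbius maps -/

/-- Complex conjugation preserves `discCosh`. [cite: Beardon1983, Thm. 7.2.1] -/
theorem discCosh_conj (z w : ℂ) : discCosh (conj z) (conj w) = discCosh z w := by
  rw [discCosh, discCosh, ← map_sub, Complex.norm_conj, Complex.norm_conj, Complex.norm_conj]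

/-- Anti-Möbius maps `z ↦ c·φ_a(z̄)` preserve `discCosh`. [cite: Beardon1983, Thm. 7.4.1] -/
theorem discCosh_discRot_conj {c a z w : ℂ} (hc : ‖c‖ = 1) (ha : ‖a‖ < 1) (hz : ‖z‖ < 1)
    (hw : ‖w‖ < 1) :
    discCosh (discRot c a (conj z)) (discRot c a (conj w)) = discCosh z w := by
  rw [discCosh_discRot hc ha (by rwa [Complex.norm_conj]) (by rwa [Complex.norm_conj]), discCosh_conj]

/-- **An anti-Möbius map is not a holomorphic automorphism**: no automorphism of the disc agrees
with `z ↦ c·φ_a(z̄)` on the disc (else complex conjugation would be holomorphic).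
[cite: Conway1978, Ch. VI Thm. 2.5] -/
theorem not_isDiscAut_of_eqOn_discRot_conj {g : ℂ → ℂ} {c a : ℂ} (hc : ‖c‖ = 1) (ha : ‖a‖ < 1)
    (hg : EqOn g (fun z => discRot c a (conj z)) (ball 0 1)) : ¬ IsDiscAut g := by
  intro hgaut
  -- `k := (c·φ_a)⁻¹ ∘ g` is an automorphism agreeing with `conj` on the disc
  obtain ⟨f', hf'd, hf'm, hf'f, hff'⟩ := (isDiscAut_discRot hc ha).exists_inverse
  have hk : IsDiscAut (f' ∘ g) :=
    (IsDiscAut.symm (isDiscAut_discRot hc ha).differentiableOn (isDiscAut_discRot hc ha).mapsTo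
      hf'd hf'm hf'f hff').comp hgaut
  have hkc : EqOn (f' ∘ g) (fun z => conj z) (ball 0 1) := by
    intro z hz
    have hz' : conj z ∈ ball (0 : ℂ) 1 := by
      rwa [mem_ball_zero_iff, Complex.norm_conj, ← mem_ball_zero_iff]
    simp only [comp_apply, hg hz, hf'f _ hz']
  -- hence `conj` would be ℂ-differentiable at `1/2`
  have hhalf : (1 / 2 : ℂ) ∈ ball (0 : ℂ) 1 := by rw [mem_ball_zero_iff]; norm_num
  have hd : DifferentiableAt ℂ (fun z : ℂ => conj z) (1 / 2) := by
    have h1 : DifferentiableAt ℂ (f' ∘ g) (1 / 2) :=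
      hk.differentiableOn.differentiableAt (isOpen_ball.mem_nhds hhalf)
    exact (Filter.EventuallyEq.differentiableAt_iff
      (Filter.eventually_of_mem (isOpen_ball.mem_nhds hhalf) fun z hz => (hkc hz).symm)).2 h1
  -- contradiction with Cauchy–Riemann
  have hcj : (fun z : ℂ => conj z) = ⇑Complex.conjCLE := funext fun z => (Complex.conjCLE_apply z).symm
  have cr := (differentiableAt_complex_iff_differentiableAt_real.1 hd).2
  rw [hcj, Complex.conjCLE.fderiv] at cr
  simp only [ContinuousLinearEquiv.coe_coe, Complex.conjCLE_apply, Complex.conj_I, map_one,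
    smul_eq_mul, mul_one] at cr
  have := congrArg Complex.im cr
  norm_num at this

/-- The square of an anti-Möbius map is a Möbius map (on the disc):
`(c·φ_a ∘ conj) ∘ (c·φ_a ∘ conj) = (c·φ_a) ∘ (c̄·φ_{ā})`. [cite: Conway1978, Ch. VI Thm. 2.5] -/
theorem isDiscAut_discRot_conj_sq {c a : ℂ} (hc : ‖c‖ = 1) (ha : ‖a‖ < 1) :
    ∃ g : ℂ → ℂ, IsDiscAut g ∧
      EqOn ((fun z => discRot c a (conj z)) ∘ fun z => discRot c a (conj z)) g (ball 0 1) := by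
  refine ⟨discRot c a ∘ discRot (conj c) (conj a), (isDiscAut_discRot hc ha).comp
    (isDiscAut_discRot (by rwa [Complex.norm_conj]) (by rwa [Complex.norm_conj])), fun z _ => ?_⟩
  simp only [comp_apply]
  congr 1
  have : conj (discRot c a (conj z)) = discRot (conj c) (conj a) z := by
    rw [discRot, discRot, map_mul]
    congr 1
    simp only [discMobius, map_div₀, map_sub, map_mul, map_one, Complex.conj_conj]
  exact this

end Literature.Analysis.Complex
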